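import Summits.AtomisticToContinuum.BoseEinsteinCondensation.Theses.BECStronglyRayleigh
import Summits.AtomisticToContinuum.BoseEinsteinCondensation.Theorems.InsertionFieldDelocalisation.Negative.Toolkit
import Summits.AtomisticToContinuum.BoseEinsteinCondensation.Theorems.InsertionFieldDelocalisation.Negative.PerronExistence
import Summits.AtomisticToContinuum.BoseEinsteinCondensation.Theorems.InsertionFieldDelocalisation.Negative.Tightness
import Summits.AtomisticToContinuum.BoseEinsteinCondensation.Theorems.BECStronglyRayleighSectorGroundStatePerron
import Literature.MathematicalPhysics.QuantumLattice.LiebMattisSectorPF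
import Literature.MathematicalPhysics.QuantumLattice.PerronFrobeniusGroundState
import HarnessLib

/-!
# Stub `stub_amplitudePos` (S2) of line `log-insertion-infrared-bound`, crux
# `BECStronglyRayleigh.InsertionFieldDelocalisation` (stmt-AtomisticToContinuum-9673)

**Perron–Frobenius positivity in a magnetisation sector of the hard-core Bose gas on `(ℤ/Lℤ)³`.**
For `xyTorus 3 L 1 = xxzHamiltonian 1 (torusGraph 3 L) (-1) 0` (occupied = spin up = index `0`), a
nonzero, entrywise real-nonnegative vector `ψ` of the sector `S³_tot = N - L³/2` (weight `L³ - N`)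
with `H ψ = E_min(sector) ψ` is strictly positive on the occupation indicator of every `N`-set `S`.

Proof (Lieb–Wu, Physica A 321 (2003) §2, item 2; Tasaki (2020) §2.4): compress `H` to the weight
sector `ι = {σ // Σ σ = L³ - N}`; the compression has real entries, nonpositive off-diagonal real
parts (`leadPF_entries` at `Δ = 0`, `μ = 0`) and a connected graph (hops of the Heisenberg exchange
inside a weight sector of the connected torus graph, `LiebMattis.reflTransGen_subtype`). The real
part `r = Re ψ|ι ≥ 0` is a nonzero real solution of `B r = E r` (`ψ` vanishes off the sector and is
real), so `PerronFrobenius.pos_of_nonneg` (a zero of a nonnegative eigenvector propagates along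
nonzero matrix elements) gives `r > 0` on `ι`; the indicator of an `N`-set has weight `L³ - N`.
Only the eigen-equation is used, not minimality of `E`.
-/

noncomputable section

open scoped BigOperators
open Literature.MathematicalPhysics.QuantumLattice Literature.Probability.LatticeModels
open Summit.AtomisticToContinuum.BoseEinsteinCondensation.Theorems.InsertionFieldDelocalisation.Negative


namespace Summit.AtomisticToContinuum.BoseEinsteinCondensation.Cruxes.InsertionFieldDelocalisation.LogInsertionInfraredBound

open Matrix Finset

/-- **Positivity of nonnegative sector eigenvectors of a stoquastic, hop-ergodic spin-½ matrix.**
Let `H` be a matrix on spin-½ configurations over `Λ` with real entries, nonpositive off-diagonal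
real parts, and nonzero at every off-diagonal position where the Heisenberg exchange
`heisenbergHamiltonian 1 G 1` of a connected graph `G` is nonzero. If `ψ` vanishes outside the
weight sector `W`, is nonzero, entrywise real nonnegative, and satisfies `H ψ = E ψ` for a real `E`,
then `Re ψ σ > 0` for every `σ` of weight `W`. (Compression to the sector + `pos_of_nonneg`.)
Lieb–Wu, Physica A 321 (2003) §2, item 2; Tasaki (2020) §2.4. [folklore] -/
theorem s2pos_sector_re_pos_of_nonneg {Λ : Type*} [Fintype Λ] [DecidableEq Λ]
    (G : SimpleGraph Λ) [DecidableRel G.Adj] (hG : G.Connected) (H : Op Λ 2)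
    (hhop : ∀ σ τ : TensorIndex Λ 2, σ ≠ τ → heisenbergHamiltonian 1 G 1 σ τ ≠ 0 → H σ τ ≠ 0)
    (hreal : ∀ σ τ : TensorIndex Λ 2, star (H σ τ) = H σ τ)
    (hoff : ∀ σ τ : TensorIndex Λ 2, σ ≠ τ → (H σ τ).re ≤ 0)
    (W : ℕ) {ψ : TensorIndex Λ 2 → ℂ} (hψK : ∀ σ, (∑ z, (σ z : ℕ)) ≠ W → ψ σ = 0) (hψ0 : ψ ≠ 0)
    {E : ℝ} (hHψ : H *ᵥ ψ = (E : ℂ) • ψ) (hnn : ∀ σ, 0 ≤ (ψ σ).re ∧ (ψ σ).im = 0) :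
    ∀ σ : TensorIndex Λ 2, (∑ z, (σ z : ℕ)) = W → 0 < (ψ σ).re := by
  -- adapted from `stoquastic_sector_perronFrobenius` (BECStronglyRayleighSectorGroundStatePerron)
  set ι := {σ : TensorIndex Λ 2 // (∑ z, (σ z : ℕ)) = W}
  set B : Matrix ι ι ℂ := Matrix.of fun s t => H s.1 t.1 with hBdef
  have hBapply : ∀ s t : ι, B s t = H s.1 t.1 := fun s t => rfl
  have hBreal : ∀ s t : ι, star (B s t) = B s t := fun s t => hreal _ _
  have hBoff : ∀ s t : ι, s ≠ t → (B s t).re ≤ 0 := fun s t hst =>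
    hoff _ _ (fun h => hst (Subtype.ext h))
  -- connectivity of the hop graph inside the sector (diagonal steps are irrelevant)
  have hBaux : ∀ s t : ι, heisenbergHamiltonian 1 G 1 s.1 t.1 ≠ 0 →
      (Matrix.of fun s t : ι => if s = t then (1 : ℂ) else B s t) s t ≠ 0 := by
    intro s t hst
    by_cases hst' : s = t
    · rw [Matrix.of_apply, if_pos hst']
      exact one_ne_zero
    · rw [Matrix.of_apply, if_neg hst', hBapply]
      exact hhop _ _ (fun h => hst' (Subtype.ext h)) hst
  have hconn : ∀ s t : ι, Relation.ReflTransGen (fun a b => B a b ≠ 0) s t := by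
    intro s t
    have h := LiebMattis.reflTransGen_subtype 1 G 1 hG one_pos W hBaux s t
    induction h with
    | refl => exact Relation.ReflTransGen.refl
    | @tail b c _ hbc ih =>
      by_cases hbc' : b = c
      · subst hbc'
        exact ih
      · refine ih.tail ?_
        rwa [Matrix.of_apply, if_neg hbc'] at hbc
  -- `ψ` is real; its restriction to the sector as a real vector
  have hψre : ∀ σ, ψ σ = (((ψ σ).re : ℝ) : ℂ) := fun σ =>
    Complex.ext (by simp) (by simp [(hnn σ).2])
  set r : ι → ℝ := fun s => (ψ s.1).re with hrdef
  have hr0 : ∀ i, 0 ≤ r i := fun i => (hnn i.1).1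
  have hrne : r ≠ 0 := by
    intro h
    apply hψ0
    funext σ
    by_cases hσ : (∑ z, (σ z : ℕ)) = W
    · have h1 : (ψ σ).re = 0 := congrFun h ⟨σ, hσ⟩
      rw [hψre σ, h1, Complex.ofReal_zero, Pi.zero_apply]
    · exact hψK σ hσ
  have hfun : (fun j : ι => ((r j : ℝ) : ℂ)) = fun s : ι => ψ s.1 :=
    funext fun s => (hψre s.1).symm
  have hr : (B *ᵥ fun j => ((r j : ℝ) : ℂ)) = (E : ℂ) • fun j => ((r j : ℝ) : ℂ) := by
    rw [hfun]
    funext s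
    rw [Pi.smul_apply, smul_eq_mul, mulVec, dotProduct]
    have h := congrFun hHψ s.1
    rw [Pi.smul_apply, smul_eq_mul, mulVec, dotProduct,
      sum_eq_sum_subtype_of_support (fun σ => (∑ z, (σ z : ℕ)) = W)] at h
    · exact h
    · intro τ hτ
      rw [hψK τ hτ, mul_zero]
  have hpos := PerronFrobenius.pos_of_nonneg hBreal hBoff hconn hr0 hrne hr
  intro σ hσ
  exact hpos ⟨σ, hσ⟩

/-- **S2 · `stub_amplitudePos`.** Perron–Frobenius positivity in a magnetisation sector of the
hard-core Bose gas on `(ℤ/Lℤ)³`: a nonzero, entrywise real-nonnegative vector of the sector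
`S³_tot = N - L³/2` of `xyTorus 3 L 1` satisfying the eigen-equation at the sector energy is strictly
positive on the occupation indicator (occupied = index `0`) of every `N`-set. (The XY Hamiltonian has
the entries of the field XXZ Hamiltonian at `Δ = 0`, `μ = 0` — real, `-½ ≤ 0` per hop — by
`leadPF_entries`; the torus graph is connected; `s2pos_sector_re_pos_of_nonneg`; an `N`-set indicator
has weight `L³ - N`.) Lieb–Wu, Physica A 321 (2003) §2; Tasaki (2020) §2.4. [folklore] -/
theorem stub_amplitudePos :
    ∀ (L : ℕ) [NeZero L], 2 ≤ L → ∀ N : ℕ, 2 ≤ N → 2 * N ≤ L ^ 3 →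
      ∀ ψ : TensorIndex (TorusSite 3 L) 2 → ℂ,
        ψ ∈ spinZSector 1 ((N : ℝ) - (L : ℝ) ^ 3 / 2) → ψ ≠ 0 →
        (xyTorus 3 L 1).mulVec ψ =
          ((lowestEnergyInSector 1 (xyTorus 3 L 1) ((N : ℝ) - (L : ℝ) ^ 3 / 2) : ℝ) : ℂ) • ψ →
        (∀ σ, 0 ≤ (ψ σ).re ∧ (ψ σ).im = 0) →
        ∀ S : Finset (TorusSite 3 L), S.card = N → 0 < (ψ (fun x => if x ∈ S then 0 else 1)).re := by
  intro L _ _hL N _hN hNL ψ hψK hψ0 hHψ hnn S hS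
  have hNle : N ≤ L ^ 3 := by omega
  -- entries of `xyTorus 3 L 1 = xxzHamiltonian 1 (torusGraph 3 L) (-1) 0 + Σ_x 0 • S³_x`
  have hent := Summit.AtomisticToContinuum.BoseEinsteinCondensation.Cruxes.GroundStateStability.StableConeVariationalSelection.leadPF_entries
    (torusGraph 3 L) 0 (fun _ => (0 : ℝ))
  simp only [Complex.ofReal_zero, zero_smul, Finset.sum_const_zero, add_zero] at hent
  obtain ⟨happ, hreal, -, hoff, -⟩ := hent
  -- the sector `N - L³/2` is the weight sector `W = L³ - N`
  have hM : ((Fintype.card (TorusSite 3 L) * 1 : ℕ) : ℝ) / 2 - ((L ^ 3 - N : ℕ) : ℝ) =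
      (N : ℝ) - (L : ℝ) ^ 3 / 2 := by
    rw [card_torusSite, Nat.cast_sub hNle]
    push_cast
    ring
  have hψW : ∀ σ : TensorIndex (TorusSite 3 L) 2, (∑ z, (σ z : ℕ)) ≠ L ^ 3 - N → ψ σ = 0 := by
    rw [← hM] at hψK
    exact (LiebMattis.mem_spinZSector_weight_iff 1 (L ^ 3 - N) ψ).1 hψK
  have hpos := s2pos_sector_re_pos_of_nonneg (torusGraph 3 L)
    (Summit.AtomisticToContinuum.BoseEinsteinCondensation.Theorems.BECStronglyRayleighSectorPerron.torusGraph_connected 3 L)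
    (xyTorus 3 L 1) (fun σ τ hστ h h0 => h (neg_eq_zero.1 ((happ σ τ hστ).symm.trans h0)))
    hreal hoff (L ^ 3 - N) hψW hψ0 hHψ hnn
  refine hpos _ ?_
  rw [weight_ind S, Finset.card_compl, hS, card_torusSite]

end Summit.AtomisticToContinuum.BoseEinsteinCondensation.Cruxes.InsertionFieldDelocalisation.LogInsertionInfraredBound

end
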